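import Literature.NumberTheory.Automorphic.CompactCoreCentralizerBounded     -- ★ (A-p03, FILE A): coordinates `∑ cᵢ γⁱ` of the commutant, eigen-coordinates, the closed-embedding ∕ Lagrange machinery
import Literature.LinearAlgebra.Matrix.RegularSemisimpleConjClassClosed       -- ★ `continuous_charpoly_coeff`
import Mathlib.LinearAlgebra.Matrix.ToLinearEquiv
import HarnessLib

/-!
# The elements of the centraliser of a regular semisimple `γ ∈ GL_N(F)` that are CONJUGATE INTO A FIXED COMPACT SET lie in a compact subset of the
# centraliser (Harish-Chandra 1970, Lemma 42 ∕ van Dijk 1972 §2: the torus-side support of `(x, t) ↦ x t x⁻¹` over a compact set; Rogawski 1990 §12.5 p. 182)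

Topic `NumberTheory/Automorphic`; namespace `Literature.NumberTheory.Automorphic`.  THEOREMS ONLY (no definition, no instance, no notation, no named fact, no
`sorry`).  Cell `pub/hodgecm-mathlib`, crux H413 = `stmt-HodgeConjecture-24833` (lane `--supports`, count-neutral), ROAD «UP-TR» (holder F0P3-p02 (g23)),
brick **(A0-iv) «SUPPORT COMPACTNESS ON THE SPLIT TORUS»** (holder's gap flag 2026-09-02T18:13:41Z; dealt to this seat by the (A0) owner F0P2-p01 (g24)
19:20:15Z) — the GENERIC MODEL half (iv-a); the CM dock (iv-b) onto `Gqs L v` is LH1-p01 (g13)'s.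

THE MATHEMATICS.  `F` a proper (hence complete), non-trivially normed ULTRAMETRIC field (e.g. `L_w`), `γ ∈ GL_N(F)` with SEPARABLE characteristic polynomial, `Z = Z(γ)`
its centraliser (a maximal torus, of any type — compact, split or mixed), `K ⊆ GL_N(F)` compact.  CLAIM: `S_K := {z ∈ Z ∣ ∃ x ∈ GL_N(F), x z x⁻¹ ∈ K}` lies in a
COMPACT subset of `Z`.  Proof (the eigen-coordinate method of ★ FILE A, with power-boundedness replaced by a Cauchy bound): every `z ∈ Z` is `∑ cᵢ γⁱ` (★); at a root
`t` of `χ_γ` in the splitting field, the eigen-coordinate `a_t(z) = ∑ cᵢ tⁱ` is an EIGENVALUE of `z` (`z v_t = a_t(z) v_t` on the `t`-eigenvector of `γ`, §1), hence a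
root of `χ_z = χ_{x z x⁻¹}`, whose coefficients are bounded on `K` (continuity); the ultrametric CAUCHY BOUND (§2) gives `spectralNorm a_t(z) ≤ max 1 B`; LAGRANGE
interpolation at the `N` distinct roots (§3, as in ★ `exists_forall_norm_coord_le`) bounds `‖cᵢ‖`; the same for `z⁻¹` (conjugate into `K⁻¹`); so `(z, z⁻¹)` lies
in the image of a closed box under the coordinate map, compact, and `Units.embedProduct`, `Subtype.val` are closed embeddings (§4, as ★ FILE A §3).
No case distinction on the type of the torus and no torus chart is used.

* §1 `exists_eigenvector_of_aeval_charpoly_eq_zero`, `pow_map_mulVec_eq_pow_smul`, **`isRoot_charpoly_map_aeval_of_sum_smul_pow_eq`** (the eigen-coordinate is a root of `χ_z`).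
* §2 **`spectralNorm_le_of_isRoot_map_of_monic`** (ultrametric Cauchy bound for the spectral norm).
* §3 **`exists_forall_norm_coord_le_of_charpoly_coeff_le`** (coordinates bounded linearly in the coefficient bound).
* §4 **`exists_isCompact_forall_mem_centralizer_of_conj_mem`** — the (A0-iv) model head: `∃ C ⊆ ↥Z(γ)` compact with `S_K ⊆ C`.
HONEST LABEL: elementary structure of tori of `GL_N` over a local field; HC_CM is proved only modulo the printed citations until rung 0 closes; this file moves no count.

## References
* [HarishChandra1970] Harish-Chandra (notes by G. van Dijk), *Harmonic Analysis on Reductive p-adic Groups*, LNM 162 (1970), Lemma 42.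
* [Rogawski1990] J. D. Rogawski, *Automorphic Representations of Unitary Groups in Three Variables* (1990), §12.5 p. 182.
* [BoschGuntzerRemmert1984] S. Bosch, U. Güntzer, R. Remmert, *Non-Archimedean Analysis* (1984), 3.1.2∕1 (roots bounded by the spectral value).
* [HornJohnson2013] R. A. Horn, C. R. Johnson, *Matrix Analysis*, 2nd ed. (2013), Thm. 3.2.4.2 (the commutant of a non-derogatory matrix), Thm. 1.1.6 (spectral mapping).
* [Tits1979] J. Tits, *Reductive groups over local fields*, Proc. Sympos. Pure Math. 33.1 (1979), §3.9.
-/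

set_option autoImplicit false

noncomputable section

open Set Filter Topology Polynomial
open scoped Pointwise Matrix MatrixGroups

namespace Literature.NumberTheory.Automorphic

/-! ## §1 The eigen-coordinate `a_t(z) = ∑ cᵢ tⁱ` of `z = ∑ cᵢ γⁱ` is a root of `χ_z` -/

section Eigen

variable {F : Type*} [Field F] {N : ℕ} {γ : Matrix (Fin N) (Fin N) F}
  {L : Type*} [Field L] [Algebra F L]

/-- A root `t` of `χ_γ` in an extension field `L` carries an eigenvector of `γ ⊗ L`: `∃ v ≠ 0, (γ.map ι) v = t • v` (`det (t − γ) = χ_γ(t) = 0`,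
Mathlib `Matrix.eval_charpoly`, `Matrix.exists_mulVec_eq_zero_iff`). [cite: HornJohnson2013, Thm. 1.1.6] -/
theorem exists_eigenvector_of_aeval_charpoly_eq_zero {t : L} (ht : aeval t γ.charpoly = 0) :
    ∃ v : Fin N → L, v ≠ 0 ∧ (γ.map (algebraMap F L)) *ᵥ v = t • v := by
  have hdet : (Matrix.scalar (Fin N) t - γ.map (algebraMap F L)).det = 0 := by
    rw [← Matrix.eval_charpoly, Matrix.charpoly_map, eval_map, ← aeval_def, ht]
  obtain ⟨v, hv0, hv⟩ := Matrix.exists_mulVec_eq_zero_iff.2 hdet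
  refine ⟨v, hv0, ?_⟩
  rw [Matrix.sub_mulVec, sub_eq_zero] at hv
  rw [← hv]
  ext i
  rw [Matrix.scalar_apply, Matrix.mulVec_diagonal, Pi.smul_apply, smul_eq_mul]

/-- On a `t`-eigenvector `v` of `γ ⊗ L`: `(γ ⊗ L)ⁱ v = tⁱ • v`. [cite: HornJohnson2013, Thm. 1.1.6] -/
theorem pow_map_mulVec_eq_pow_smul {t : L} {v : Fin N → L} (hv : (γ.map (algebraMap F L)) *ᵥ v = t • v) (i : ℕ) :
    ((γ.map (algebraMap F L)) ^ i) *ᵥ v = t ^ i • v := by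
  induction i with
  | zero => rw [pow_zero, pow_zero, Matrix.one_mulVec, one_smul]
  | succ n ih => rw [pow_succ, ← Matrix.mulVec_mulVec, hv, Matrix.mulVec_smul, ih, smul_smul, pow_succ, mul_comm]

/-- **SPECTRAL MAPPING FOR THE COMMUTANT COORDINATES**: if `z = ∑_{i<N} cᵢ • γⁱ` and `t ∈ L` is a root of `χ_γ`, then the eigen-coordinate `a_t(z) = aeval t (∑ C cᵢ Xⁱ)`
is a root of `χ_z` (mapped to `L`): `z ⊗ L` acts on the `t`-eigenvector of `γ ⊗ L` by `a_t(z)`. [cite: HornJohnson2013, Thm. 1.1.6; Thm. 3.2.4.2] -/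
theorem isRoot_charpoly_map_aeval_of_sum_smul_pow_eq {c : Fin N → F} {z : Matrix (Fin N) (Fin N) F} (hz : ∑ i : Fin N, c i • γ ^ (i : ℕ) = z)
    {t : L} (ht : aeval t γ.charpoly = 0) :
    (z.charpoly.map (algebraMap F L)).IsRoot (aeval t (∑ i : Fin N, C (c i) * X ^ (i : ℕ))) := by
  obtain ⟨v, hv0, hv⟩ := exists_eigenvector_of_aeval_charpoly_eq_zero ht
  set a : L := aeval t (∑ i : Fin N, C (c i) * X ^ (i : ℕ)) with ha
  -- `z ⊗ L = ∑ cᵢ • (γ ⊗ L)ⁱ`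
  have hzL : z.map (algebraMap F L) = ∑ i : Fin N, c i • (γ.map (algebraMap F L)) ^ (i : ℕ) := by
    rw [← hz, ← RingHom.mapMatrix_apply, map_sum]
    refine Finset.sum_congr rfl fun i _ => ?_
    rw [RingHom.mapMatrix_apply, Matrix.map_smul _ _ (fun x => by rw [Algebra.smul_def, map_mul, Algebra.smul_def, Algebra.algebraMap_self_apply]),
      ← RingHom.mapMatrix_apply, map_pow, RingHom.mapMatrix_apply]
  -- it acts on `v` by `a`
  have hact : (z.map (algebraMap F L)) *ᵥ v = a • v := by
    rw [hzL, Matrix.sum_mulVec, ha, aeval_sum_C_mul_X_pow, Finset.sum_smul]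
    refine Finset.sum_congr rfl fun i _ => ?_
    rw [Matrix.smul_mulVec, pow_map_mulVec_eq_pow_smul hv]
    exact (smul_assoc (c i) (t ^ (i : ℕ)) v).symm
  -- hence `det (a − z ⊗ L) = 0`
  have hker : (Matrix.scalar (Fin N) a - z.map (algebraMap F L)) *ᵥ v = 0 := by
    rw [Matrix.sub_mulVec, hact, sub_eq_zero]
    ext i
    rw [Matrix.scalar_apply, Matrix.mulVec_diagonal, Pi.smul_apply, smul_eq_mul]
  rw [IsRoot.def, ← Matrix.charpoly_map, Matrix.eval_charpoly]
  exact Matrix.exists_mulVec_eq_zero_iff.1 ⟨v, hv0, hker⟩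

end Eigen

/-! ## §2 The ultrametric Cauchy bound for the spectral norm of a root of a monic polynomial -/

section Cauchy

variable {F : Type*} [NontriviallyNormedField F] [IsUltrametricDist F]
  {L : Type*} [Field L] [Algebra F L] [Algebra.IsAlgebraic F L]

/-- **CAUCHY BOUND (ultrametric, spectral norm).**  For a MONIC `p ∈ F[X]` whose coefficients have norm `≤ B` and a root `a` of `p` in an algebraic extension `L`,
`spectralNorm F L a ≤ max 1 B`: from `aⁿ = −∑_{i<n} pᵢ aⁱ` and the non-archimedean inequality, `s(a)ⁿ ≤ B · max(1, s(a))ⁿ⁻¹`. [cite: BoschGuntzerRemmert1984, 3.1.2/1] -/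
theorem spectralNorm_le_of_isRoot_map_of_monic {p : F[X]} (hp : p.Monic) {B : ℝ} (hB : ∀ i, ‖p.coeff i‖ ≤ B)
    {a : L} (ha : (p.map (algebraMap F L)).IsRoot a) :
    spectralNorm F L a ≤ max 1 B := by
  have hna := isNonarchimedean_spectralNorm (K := F) (L := L)
  have hs0 : spectralNorm F L 0 = 0 := spectralNorm_zero
  have hsnn : ∀ y, 0 ≤ spectralNorm F L y := spectralNorm_nonneg
  -- power-multiplicativity (all exponents)
  have hspow : ∀ (x : L) (n : ℕ), spectralNorm F L (x ^ n) = spectralNorm F L x ^ n := by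
    intro x n
    rcases Nat.eq_zero_or_pos n with rfl | hn
    · rw [pow_zero, pow_zero]; exact spectralNorm_one
    · exact isPowMul_spectralNorm x hn
  by_contra hlt
  rw [not_le] at hlt
  have h1 : 1 < spectralNorm F L a := lt_of_le_of_lt (le_max_left _ _) hlt
  have hBlt : B < spectralNorm F L a := lt_of_le_of_lt (le_max_right _ _) hlt
  have hB0 : 0 ≤ B := (norm_nonneg _).trans (hB 0)
  -- the degree `n ≥ 1`
  set n := p.natDegree with hn
  have hn0 : n ≠ 0 := by
    intro h0
    have hp1 : p = 1 := (Polynomial.Monic.natDegree_eq_zero hp).1 h0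
    rw [hp1, Polynomial.map_one, IsRoot.def, eval_one] at ha
    exact one_ne_zero ha
  -- `aⁿ = −∑_{i<n} (ι pᵢ) aⁱ`
  have hsum : a ^ n = -∑ i ∈ Finset.range n, algebraMap F L (p.coeff i) * a ^ i := by
    have h := ha
    rw [IsRoot.def, eval_map, ← aeval_def, aeval_eq_sum_range, Finset.sum_range_succ, ← hn, hp.coeff_natDegree, one_smul] at h
    rw [eq_neg_iff_add_eq_zero, add_comm]
    simpa only [Algebra.smul_def] using h
  -- the non-archimedean estimate of the right-hand side
  have hle : spectralNorm F L (a ^ n) ≤ B * spectralNorm F L a ^ (n - 1) := by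
    rw [hsum, spectralNorm_neg (Algebra.IsAlgebraic.isAlgebraic _)]
    refine apply_sum_le_of_isNonarchimedean hna hs0 _ _ (mul_nonneg hB0 (pow_nonneg (hsnn a) _)) fun i hi => ?_
    rw [Finset.mem_range] at hi
    refine (spectralNorm_mul (Algebra.IsAlgebraic.isAlgebraic _) (Algebra.IsAlgebraic.isAlgebraic _)).trans ?_
    rw [spectralNorm_extends, hspow]
    refine mul_le_mul (hB i) ?_ (pow_nonneg (hsnn a) _) hB0
    exact pow_le_pow_right₀ h1.le (by omega)
  rw [hspow] at hle
  -- `s(a)ⁿ = s(a) · s(a)ⁿ⁻¹ > B · s(a)ⁿ⁻¹`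
  have hpos : 0 < spectralNorm F L a ^ (n - 1) := pow_pos (lt_trans zero_lt_one h1) _
  have hle' : spectralNorm F L a * spectralNorm F L a ^ (n - 1) ≤ B * spectralNorm F L a ^ (n - 1) := by
    rw [← pow_succ', Nat.sub_add_cancel (Nat.one_le_iff_ne_zero.2 hn0)]; exact hle
  exact absurd (lt_of_lt_of_le (mul_lt_mul_of_pos_right hBlt hpos) hle') (lt_irrefl _)

end Cauchy

/-! ## §3 Coordinates bounded by the characteristic-polynomial coefficients -/

section Coord

variable {F : Type*} [NontriviallyNormedField F] [IsUltrametricDist F] {N : ℕ}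
  (γ : Matrix (Fin N) (Fin N) F)

/-- **THE COORDINATE BOUND FROM `χ_z`.**  For `γ` regular semisimple over a complete ultrametric field there is `R = R(γ) ≥ 0` such that: whenever `z = ∑ cᵢ γⁱ` and the
coefficients of `χ_z` have norm `≤ B` with `1 ≤ B`, then `‖cⱼ‖ ≤ B · R` for all `j` (eigen-coordinates are roots of `χ_z` (§1), Cauchy (§2), Lagrange at the `N` distinct
roots of `χ_γ` as in ★ `exists_forall_norm_coord_le`). [cite: BoschGuntzerRemmert1984, 3.1.2/1] [cite: HornJohnson2013, Thm. 3.2.4.2] -/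
theorem exists_forall_norm_coord_le_of_charpoly_coeff_le (hγ : γ.charpoly.Separable) :
    ∃ R : ℝ, 0 ≤ R ∧ ∀ (c : Fin N → F) (z : Matrix (Fin N) (Fin N) F), ∑ i : Fin N, c i • γ ^ (i : ℕ) = z →
      ∀ B : ℝ, 1 ≤ B → (∀ i, ‖z.charpoly.coeff i‖ ≤ B) → ∀ j, ‖c j‖ ≤ B * R := by
  classical
  -- the splitting field, its spectral norm, the N distinct roots (as in ★ FILE A)
  obtain ⟨s, hscard, hsroot⟩ : ∃ s : Finset γ.charpoly.SplittingField,
      s.card = N ∧ ∀ t ∈ s, aeval t γ.charpoly = 0 := by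
    refine ⟨(γ.charpoly.map (algebraMap F γ.charpoly.SplittingField)).roots.toFinset, ?_, fun t ht => ?_⟩
    · rw [Multiset.toFinset_card_of_nodup (nodup_roots hγ.map), ← (SplittingField.splits γ.charpoly).natDegree_eq_card_roots,
        natDegree_map, Matrix.charpoly_natDegree_eq_dim, Fintype.card_fin]
    · rw [Multiset.mem_toFinset, mem_roots', IsRoot.def, eval_map, ← aeval_def] at ht
      exact ht.2
  have hna := isNonarchimedean_spectralNorm (K := F) (L := γ.charpoly.SplittingField)
  have hf0 : spectralNorm F γ.charpoly.SplittingField 0 = 0 := spectralNorm_zero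
  have hfnn : ∀ y, 0 ≤ spectralNorm F γ.charpoly.SplittingField y := spectralNorm_nonneg
  refine ⟨∑ t ∈ s, ∑ j ∈ Finset.range N, spectralNorm F γ.charpoly.SplittingField ((Lagrange.basis s id t).coeff j),
    Finset.sum_nonneg fun t _ => Finset.sum_nonneg fun j _ => hfnn _, ?_⟩
  intro c z hcz B hB1 hBcoeff j
  have hB0 : 0 ≤ B := zero_le_one.trans hB1
  -- (c) at every root `t`, the eigen-coordinate of `z` has spectral norm ≤ B
  have hev : ∀ t ∈ s, spectralNorm F γ.charpoly.SplittingField (aeval t (∑ i : Fin N, C (c i) * X ^ (i : ℕ))) ≤ B := by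
    intro t ht
    have hroot := isRoot_charpoly_map_aeval_of_sum_smul_pow_eq hcz (hsroot t ht)
    exact (spectralNorm_le_of_isRoot_map_of_monic (Matrix.charpoly_monic z) hBcoeff hroot).trans (max_le hB1 le_rfl)
  -- (d) Lagrange interpolation at the `N` roots recovers the coefficients
  set q : (γ.charpoly.SplittingField)[X] := (∑ i : Fin N, C (c i) * X ^ (i : ℕ)).map (algebraMap F γ.charpoly.SplittingField)
    with hq
  have hqdeg : q.degree < s.card := by
    rw [hq, degree_map, hscard]
    exact degree_sum_fin_lt c
  have hcoeff : q.coeff j = ∑ t ∈ s, q.eval t * (Lagrange.basis s id t).coeff j := by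
    have h := Lagrange.eq_interpolate (s := s) (v := id) (f := q) (fun _ _ _ _ h => h) hqdeg
    conv_lhs => rw [h]
    rw [Lagrange.interpolate_apply, finsetSum_coeff]
    refine Finset.sum_congr rfl fun t _ => ?_
    rw [coeff_C_mul, id]
  have hqj : q.coeff j = algebraMap F γ.charpoly.SplittingField (c j) := by
    rw [hq, coeff_map, coeff_sum_C_mul_X_pow]
  have hqeval : ∀ t, q.eval t = aeval t (∑ i : Fin N, C (c i) * X ^ (i : ℕ)) := fun t => by
    rw [hq, ← eval₂_eq_eval_map, aeval_def]
  -- (e) the bound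
  rw [← spectralNorm_extends (L := γ.charpoly.SplittingField) (c j), ← hqj, hcoeff]
  refine apply_sum_le_of_isNonarchimedean hna hf0 _ _
    (mul_nonneg hB0 (Finset.sum_nonneg fun t _ => Finset.sum_nonneg fun j _ => hfnn _)) fun t ht => ?_
  refine (spectralNorm_mul (Algebra.IsAlgebraic.isAlgebraic _) (Algebra.IsAlgebraic.isAlgebraic _)).trans ?_
  rw [hqeval]
  refine mul_le_mul (hev t ht) ?_ (hfnn _) hB0
  have hjN : (j : ℕ) ∈ Finset.range N := Finset.mem_range.2 j.2
  exact (Finset.single_le_sum (f := fun j => spectralNorm F γ.charpoly.SplittingField ((Lagrange.basis s id t).coeff j))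
    (fun j _ => hfnn _) hjN).trans
    (Finset.single_le_sum (f := fun t => ∑ j ∈ Finset.range N, spectralNorm F γ.charpoly.SplittingField ((Lagrange.basis s id t).coeff j))
      (fun t _ => Finset.sum_nonneg fun j _ => hfnn _) ht)

end Coord

/-! ## §4 `GL_N(F)`: the elements of `Z(γ)` conjugate into a compact set lie in a compact subset of `Z(γ)` -/

section GLn

variable {F : Type*} [NontriviallyNormedField F] [IsUltrametricDist F] [ProperSpace F] {N : ℕ}
  (γ : GL (Fin N) F)

omit [IsUltrametricDist F] [ProperSpace F] in
/-- The coefficients of the characteristic polynomial are bounded on a compact set of invertible matrices (continuity, ★ `continuous_charpoly_coeff`).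
[cite: HornJohnson2013, Thm. 1.1.6] -/
theorem exists_forall_norm_charpoly_coeff_le (K : Set (GL (Fin N) F)) (hK : IsCompact K) :
    ∃ B : ℝ, 1 ≤ B ∧ ∀ g ∈ K, ∀ i, ‖((g : Matrix (Fin N) (Fin N) F).charpoly).coeff i‖ ≤ B := by
  -- only the coefficients `i ≤ N` are non-zero; each is continuous
  have hcont : ∀ i : ℕ, Continuous fun g : GL (Fin N) F => ((g : Matrix (Fin N) (Fin N) F).charpoly).coeff i := fun i =>
    (Literature.LinearAlgebra.Matrix.continuous_charpoly_coeff i).comp Units.continuous_val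
  have hbd : ∀ i : ℕ, ∃ Bi : ℝ, ∀ g ∈ K, ‖((g : Matrix (Fin N) (Fin N) F).charpoly).coeff i‖ ≤ Bi := by
    intro i
    obtain ⟨Bi, hBi⟩ := (hK.image (hcont i)).isBounded.exists_norm_le
    exact ⟨Bi, fun g hg => hBi _ ⟨g, hg, rfl⟩⟩
  choose Bi hBi using hbd
  refine ⟨max 1 (∑ i ∈ Finset.range (N + 1), max 0 (Bi i)), le_max_left _ _, fun g hg i => ?_⟩
  by_cases hi : i ≤ N
  · refine (hBi i g hg).trans ((le_max_right 0 (Bi i)).trans ?_)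
    refine le_trans ?_ (le_max_right _ _)
    exact Finset.single_le_sum (f := fun i => max 0 (Bi i)) (fun i _ => le_max_left _ _) (Finset.mem_range.2 (Nat.lt_succ_of_le hi))
  · have hzero : ((g : Matrix (Fin N) (Fin N) F).charpoly).coeff i = 0 := by
      apply coeff_eq_zero_of_natDegree_lt
      rw [Matrix.charpoly_natDegree_eq_dim, Fintype.card_fin]
      omega
    rw [hzero, norm_zero]
    exact zero_le_one.trans (le_max_left _ _)

/-- **(A0-iv) MODEL HEAD — SUPPORT COMPACTNESS ALONG A TORUS.**  `F` ultrametric and proper (e.g. a non-archimedean local field), `γ ∈ GL_N(F)` with separable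
characteristic polynomial, `K ⊆ GL_N(F)` compact: there is a COMPACT `C ⊆ Z(γ)` containing every `z ∈ Z(γ)` some conjugate `x z x⁻¹` of which lies in `K`.  (For the
Weyl-integration∕tube formulas: the torus-side support of `t ↦ Φ(t, f)`, `f` compactly supported, is relatively compact on EVERY Cartan, split ones included.)
[cite: HarishChandra1970, Lemma 42] [cite: Rogawski1990, §12.5 p. 182] [cite: Tits1979, §3.9] -/
theorem exists_isCompact_forall_mem_centralizer_of_conj_mem
    (hγ : ((γ : Matrix (Fin N) (Fin N) F).charpoly).Separable) (K : Set (GL (Fin N) F)) (hK : IsCompact K) :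
    ∃ C : Set ↥(Subgroup.centralizer ({γ} : Set (GL (Fin N) F))), IsCompact C ∧
      ∀ z : ↥(Subgroup.centralizer ({γ} : Set (GL (Fin N) F))),
        (∃ x : GL (Fin N) F, x * (z : GL (Fin N) F) * x⁻¹ ∈ K) → z ∈ C := by
  obtain ⟨R, hR0, hR⟩ := exists_forall_norm_coord_le_of_charpoly_coeff_le (γ : Matrix (Fin N) (Fin N) F) hγ
  -- one coefficient bound for `K ∪ K⁻¹`
  obtain ⟨B, hB1, hB⟩ := exists_forall_norm_charpoly_coeff_le (K ∪ K⁻¹) (hK.union hK.inv)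
  -- the compact box image in `M_N(F)`
  set C₀ : Set (Matrix (Fin N) (Fin N) F) :=
    (fun c : Fin N → F => ∑ i : Fin N, c i • (γ : Matrix (Fin N) (Fin N) F) ^ (i : ℕ)) '' Set.pi Set.univ (fun _ : Fin N => Metric.closedBall (0 : F) (B * R))
    with hC₀
  have hC₀c : IsCompact C₀ := by
    refine (isCompact_univ_pi fun _ => isCompact_closedBall (0 : F) (B * R)).image ?_
    exact continuous_finsetSum _ fun i _ => (continuous_apply i).smul continuous_const
  -- every `u ∈ Z(γ)` whose `χ` has coefficients `≤ B` lies in `C₀`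
  have hmemC₀ : ∀ u : ↥(Subgroup.centralizer ({γ} : Set (GL (Fin N) F))),
      (∀ i, ‖(((u : GL (Fin N) F) : Matrix (Fin N) (Fin N) F).charpoly).coeff i‖ ≤ B) → ((u : GL (Fin N) F) : Matrix (Fin N) (Fin N) F) ∈ C₀ := by
    intro u hu
    have hcomm : Commute (γ : Matrix (Fin N) (Fin N) F) ((u : GL (Fin N) F) : Matrix (Fin N) (Fin N) F) := by
      have h := u.2
      rw [Subgroup.mem_centralizer_singleton_iff] at h
      have h' := congrArg (fun g : GL (Fin N) F => (g : Matrix (Fin N) (Fin N) F)) h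
      simp only [Units.val_mul] at h'
      exact h'.symm
    obtain ⟨c, hc⟩ := exists_sum_smul_pow_eq_of_commute hγ hcomm
    refine ⟨c, Set.mem_univ_pi.2 fun j => ?_, hc⟩
    rw [Metric.mem_closedBall, dist_zero_right]
    exact hR c _ hc B hB1 hu j
  -- pull back the compact `C₀ × C₀ᵒᵖ` along the two closed embeddings
  have hGL : IsCompact ((Units.embedProduct (Matrix (Fin N) (Fin N) F)) ⁻¹' (C₀ ×ˢ (MulOpposite.op '' C₀))) :=
    Units.isClosedEmbedding_embedProduct.isCompact_preimage (hC₀c.prod (hC₀c.image MulOpposite.continuous_op))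
  refine ⟨(Subtype.val : ↥(Subgroup.centralizer ({γ} : Set (GL (Fin N) F))) → GL (Fin N) F) ⁻¹'
      ((Units.embedProduct (Matrix (Fin N) (Fin N) F)) ⁻¹' (C₀ ×ˢ (MulOpposite.op '' C₀))),
    (Set.isClosed_centralizer _).isClosedEmbedding_subtypeVal.isCompact_preimage hGL, ?_⟩
  rintro z ⟨x, hx⟩
  -- `χ_z = χ_{x z x⁻¹}` and `χ_{z⁻¹} = χ_{x z⁻¹ x⁻¹}`, with `x z⁻¹ x⁻¹ = (x z x⁻¹)⁻¹ ∈ K⁻¹`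
  have hconj : ∀ u : GL (Fin N) F, ((x * u * x⁻¹ : GL (Fin N) F) : Matrix (Fin N) (Fin N) F).charpoly = ((u : GL (Fin N) F) : Matrix (Fin N) (Fin N) F).charpoly := by
    intro u
    rw [Units.val_mul, Units.val_mul, Matrix.coe_units_inv, Matrix.charpoly_units_conj]
  have hz : ∀ i, ‖(((z : GL (Fin N) F) : Matrix (Fin N) (Fin N) F).charpoly).coeff i‖ ≤ B := fun i => by
    rw [← hconj]; exact hB _ (Or.inl hx) i
  have hxinv : x * ((z⁻¹ : ↥(Subgroup.centralizer ({γ} : Set (GL (Fin N) F)))) : GL (Fin N) F) * x⁻¹ ∈ K⁻¹ := by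
    rw [Set.mem_inv, Subgroup.coe_inv, mul_inv_rev, mul_inv_rev, inv_inv, inv_inv, ← mul_assoc]
    exact hx
  have hzinv : ∀ i, ‖((((z⁻¹ : ↥(Subgroup.centralizer ({γ} : Set (GL (Fin N) F)))) : GL (Fin N) F) : Matrix (Fin N) (Fin N) F).charpoly).coeff i‖ ≤ B := fun i => by
    rw [← hconj]; exact hB _ (Or.inr hxinv) i
  rw [mem_preimage, mem_preimage, Units.embedProduct_apply, mem_prod]
  exact ⟨hmemC₀ z hz, ⟨(((z⁻¹ : ↥(Subgroup.centralizer ({γ} : Set (GL (Fin N) F)))) : GL (Fin N) F) : Matrix (Fin N) (Fin N) F), hmemC₀ _ hzinv, rfl⟩⟩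

end GLn

end Literature.NumberTheory.Automorphic

end
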